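import Literature.MathematicalPhysics.QuantumFieldTheory.Balaban1983to89.B11Prop7Assembly
import Literature.MathematicalPhysics.QuantumFieldTheory.Balaban1983to89.B11Eq131Projection

/-!
# `Balaban1983to89.B11Carve14SectEHyp` — [Balaban1985Variational] pp. 294–300, Sect. E «An Analysis of Equation (111)»
# (displays (115)–(143), Propositions 6–7) CARVED IN HYPOTHESIS FORM — the residual UNNUMBERED printed statements of these
# seven pages that had no declaration, the kernel bookkeeping of the printed bound chains (133) ⇒ (136) and (137) ⇒ (140),
# the identity «GP₀* = G̃» behind (143) PROVED, and ONE bundle `B11Carve14SectEHyp.Hyp` conjoining the section's printed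
# statements BY NAME (P6 carving fan, block 14; key item stmt-QuantumFields-20541, also feeds 20544, 19200)

statement-level skeleton of published theorems with citation tags; proofs where landed; nothing here is a claim about the Yang–Mills mass gap

CITATION HEADER.  T. Bałaban, *The variational problem and background fields in renormalization group method for lattice
gauge theories*, Commun. Math. Phys. **102** (1985) 277–309, doi:10.1007/bf01229381 [Balaban1985Variational] (cell paper B11;
its refs [5] = [Balaban1985BackgroundPropagators] = B9, [6] = [Balaban1985RegularSpaces] = B8).  PDF held:
`paper:balaban1985-cmp102-variational-background` (journal page = PDF page + 276); pp. 294–300 = PDF 18–24 re-read first-hand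
on the renders `run/shared/lean/pub/pub-balaban/b2b-balaban-ref1/pages/1985-cmp102-variational-background/1985-cmp102-
variational-background-p018…p024-x2.png` (read AS IMAGES by this seat, 2026-08-28); the locators «p. N l. a» below count the
lines of the text layer `p00NN.txt` of the same pages (displays counted as lines).  The paper is a MANUSCRIPT UNDER
ADJUDICATION in this tree: every `def … : Prop` below is a PRINTED statement typed as a proposition to be used as a
HYPOTHESIS `(h : …)`; every `theorem` is kernel-checked bookkeeping between typed forms, real arithmetic of printed
constants, or linear algebra over abstract (inner-product / normed) spaces with every analytic input of the print a
hypothesis.  WHAT IS REPRODUCED = SKELETON rows B11.Prop6, B11.Prop7, B11.Eq115, Eq117, Eq119, Eq122, Claim@296, Eq123,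
Eq127, Eq129, Eq132, Eq137, Eq141, Eq143 (all IN TREE — cited, not restated; row B11.SectF (169) belongs to block 15) plus
the residual sentences listed under WHAT THIS FILE ADDS.  Unit `lit-balaban-carve-14` (HOME
`run/shared/lean/pub/lit-balaban/carve/`, rules `carve/CARVE-RULES.md`, block table `carve/BLOCKS-11-20.md` § Block 14); TWO
imports (`…B11Prop7Assembly`, hence `…B11`; `…B11Eq131Projection`, hence `…B11Eq129Minimizer`); nothing in the tree is edited.

## IN TREE = CITED (the printed items of pp. 294–300 that already have declarations; NOT restated here)

* p. 294 (115) «max{|A₁|_{(−1)}, |∇A₁|_{(−2)}} < ε₄» and p. 295 (116) the transformation «A₁ → −𝔊J − 𝔊((δ/δA′)V)(A₁ +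
  H₁B)»: row B11.Eq115 — `B11Prop6Scheme.mapT` (+ `mapT_noLinear`, `mapT_158`), the carrier field `B11.LGData.nMax`; the
  space (115) as a genuine normed space `B11Eq115Space.NegSup` / `JetSup`, kernel operators on it `B11Eq115KernelOp.*`,
  the «i.e.» of (115) `B11KernelDictionary.loc_le_iff`.
* p. 295 (117)–(118) «By Theorem 3.13 of [5] … (117) if ε₄ + B₀|B| ≤ a₃ … transforms the space (115) into itself if (118)»:
  row B11.Eq117 — `B11Prop6Scheme.bound_117`, `mapsTo_118`, `norm_arg_lt`; Thm 3.13 of [5] = `B9.Thm312_313Printed` /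
  `B9.Thm313Printed`; the concrete transformation norms `B11Eq117TransformationNorm.*` & siblings.
* p. 295 (119)–(121) «A difference of its values … (119) … (120) where we have taken r = … We have to assume also that
  2(ε₄ + B₀|B|) ≤ a₃ … contractive if (121)»: row B11.Eq119 — `B11Prop6Scheme.lipschitz_120` (the Cauchy formula on |τ| = r
  LITERALLY), `existsUnique_solution`, `norm_solution_le`; the regime letters `B11Eq118RegimeScalars.*`, `B11Eq174Chart.Regime`.
* p. 295 l. 14 «These conditions are satisfied if e.g. 2B₀C₁B₃ε₁ ≤ ε₄ and ε₄ ≤ a₄ for a sufficiently small a₄» and l. 30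
  «Assuming 2B₀C₁B₃ε₁ ≤ ε₄, the above conditions are satisfied if ε₄ ≤ a₄»: `B11.ineq118_121` (a₄ = min{a₃⁄4, (16B₀C₄)⁻¹}
  when dL ≤ B₃), `B11Prop6Scheme.le_a4_iff`; existential form `exists_a4_of_118_121` below (bookkeeping only).
* pp. 295–296 PROPOSITION 6: `B11.Prop6Printed B₀ B₃ C₁ fam` (typed statement of record) — its scheme PROVED over abstract
  Banach spaces `B11Prop6Scheme.prop6_solution`, `prop6_bound_printed`, inhabited on models `B11Prop6Model.prop6Printed_model`,
  `B11Prop6Concrete.prop6Printed_concrete`; p. 295 ll. 2–3 «We will prove that for ε₄ sufficiently small the equation has a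
  unique solution, and the solution is in the space (115) with ε₄ = O(ε₁)» IS Proposition 6 (not typed twice); p. 296 ll. 4–8
  «the analyticity follows from the fact that the solution can be constructed as a uniform limit of a sequence of successive
  approximations …»: `B11Prop6Scheme.solution_analytic`, `solution_analytic_line` (`B13Contraction113.differentiableOn_fixedPoint`).
* p. 296 ll. 9–20, the uniqueness conclusions and (122) «8ε₂ ≤ 8B₁ε₀ + 8B₁C₁ε₀ ≤ 16B₁C₁ε₀»: row B11.Eq122 —
  `B11.axial_critical_from_one_landau`, `B11.ineq122`, `B11Prop7Assembly.one_landau_of_props` (printed inequality for ε₂),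
  `second_condition_auto` («then the second condition above is satisfied automatically»), `eps2_ge_prop2`, `ineq122_le`,
  `silent_restrictions`, and the sentence «thus if B₃ε₁ ≤ ε₀ and 16B₁C₁ε₀ ≤ a₄, then the functional (5) has at most one
  critical orbit in the space (6)» = `B11Prop7Assembly.atMostOneCriticalOrbit_of_props` (a₀ = min{a₄⁄(16B₁C₁), c₁⁄(2C₁), c⁄(8B₁C₁)}).
* p. 296 ll. 21–31, the existence paragraph: row B11.Claim@296 — arithmetic «ε₄ = 2(2B₀C₁B₃ε₁ + 2dLB₀C₁ε₁) ≤ 5dLB₀C₁B₃ε₁ =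
  B₁C₁B₃ε₁» `B11.eps4_existence_bound`, «we have B₁ = 5dLB₀» `B11.B1_eq_B8Prop3`; the step (112) ↦ critical U₁ in (19)–(21)
  = the located leaf `B11Prop7Assembly.ExistenceLeaves.crit112` / `ExistenceLeavesCap.crit112`.
* pp. 296–297 (123)–(126), «Eqs. (125) have a unique solution … a critical point in the subspace (42), (43) is also a critical
  point in the space (43), (123)»: row B11.Eq123 — `B11CriticalSlice.fderiv_comp_param_eq_zero`, `critical_of_invariant_fibration`;
  the by-reference input «all the results of that section [Sect. D of [6]] are valid» = [6] Thm 8 `B8SectGH.Thm8PrintedAt` /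
  `B8.Thm8Printed` (cell GAPS G-B11-E3; cited, not restated).
* p. 297 (127)–(128): row B11.Eq127 — `B11Eq127EulerLagrange.eq127`, `eq127_of_isMinOn`, `laplaceA`, `eq128`, `eq128_iff_eq127`;
  «For the operator Δ_a⁻¹ = G we have proved Theorem 3.3 in [5]» = `B9.Thm33Printed`.
* pp. 297–298 (129)–(131), H₀B, (130), P₀: row B11.Eq129 — `B11Eq129Minimizer.hOp`, `isMinOn_hOp`, `eq_hOp_of_le`,
  `inner_delta_hOp_eq_zero` (p. 298 l. 4 «⟨δA′, Δ_aH₀B⟩ = 0»), `B11Eq131Projection.proj0`, `apply_Q_proj0`, `proj0_idem`,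
  `inner_proj0_delta_comm`; the «or» of (130) `B11KernelDictionary.ineq130_opBound`, `scaleInv` ((L^{j(·)}η)⁻¹ of (129)).
* p. 298 (132)–(136): row B11.Eq132 — `B11Eq131Projection.eq132`, `eq133_weak`, `laplaceA_apply_of_ker`; (134)–(135) PROVED on the
  lattice `B11Eq135Weitzenbock.eq134`, `eq135`, `eq135η`, `norm_curvOp_le_eps` (the «regularity condition (14)» clause); the
  carrier `B11Eq135WeitzenbockCarrier.*`.
* pp. 298–299 (137)–(140): row B11.Eq137 — `B11Eq131Projection.eq137`, `norm_eq137_le` («hence |Δ_πHB|_{(−3)} ≤ O(1)|B|»),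
  `B11Eq138Polarization.eq138`, `eq138_deltaPi` ((138)), `B11Eq135Weitzenbock.eq140`, `eq140_135` ((140)).
* p. 299 (141)–(142) and the minimality sentence: row B11.Eq141 — `B11Eq142LocalMin.eq142`, `isLocalMinOn_142`,
  `strictLocalMin_142`, `localMinOnChart_of_critical`, `B11GlobalMin.LocalMinOnChart`, `globalMin_of_chart` (the local-vs-global
  residual G-B11-E5), the located leaves `B11Prop7Assembly.ExistenceLeavesCap.axial18` (p. 299 ll. 18–23 «Proposition 7 [6]
  implies that U_k belongs to the space (18) …», [6] Prop. 7 = `B8SectGH.Prop7PrintedR` / `B8.Prop7Printed`) and `.minimal142`.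
* p. 299 PROPOSITION 7: `B11.Prop7Printed B₃ C₁ fam` (typed statement of record), assembled from Props 2, 5, 6
  `B11Prop7Assembly.prop7Printed_of_props_cap`, thresholded `B11Prop7AssemblyThresholds.*`, on models `B11Prop7Model`,
  `B11Prop7ModelBridge.prop7Printed_via_assembly`; Thm 1 ⇐ Prop 7 + Prop 8 + Sect. F `B11.thm1_of_prop7_prop8_sectF`.
* p. 300 (143) «This equation has all the properties of Eq. (111) and Proposition 6 is valid for it also»: row B11.Eq143 —
  `B11Prop6Scheme.conditions_143`, `eq143_solution`, `B11Eq143LinearTermRadii.exists_regime_radii_linear`; the located θ of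
  G̃Δ^{(2)} `B11TildeG190.theta143_of_majorants` (which READS «GP₀* = G − GQ*(QGQ*)⁻¹QG = G̃» as its hypothesis `hGt`).

## WHAT THIS FILE ADDS (residual printed sentences with no declaration; hypothesis form; bookkeeping; the bundle)

* §1 `eq111_solution_2B0` — p. 296 ll. 21–22 «Equation (111) has a solution belonging to the space (115) with ε₄ = 2B₀C₁B₃ε₁,
  if 2B₀C₁B₃ε₁ ≤ a₄» PROVED from `B11.Prop6Printed` (ε₄ := 2B₀C₁B₃ε₁).  `AtMostOneCriticalIn1921Printed` — p. 296 ll. 10–12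
  «If we take ε₄ = 8ε₂, and if we assume 8ε₂ ≤ a₄ and 2B₀C₁B₃ε₁ ≤ 8ε₂, then by Propositions 5 and 6 there is at most one
  critical configuration of (5) in (19)–(21)» typed over the Sect. A–E carrier `B11.LGData` (the LANDAU-GAUGE uniqueness; the
  tree had only its axial-gauge consequence `B11.axial_critical_from_one_landau`), with `atMostOneCriticalIn1921_of_props`:
  `Prop5Printed ∧ Prop6Printed ⇒` it (kernel).  `exists_a4_of_118_121` — p. 295 l. 14 / l. 30 in existential form.
* §2 `thm1Worse_of_prop7` — p. 299 l. 40–p. 300 l. 2 «This proposition implies Theorem 1 but with worse bounds on the minimal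
  configuration, and without the regularity results (9), (10)» (kernel: `B11.Prop7Printed` + the dictionary `B11.VarProblemX.Laws`
  ⇒ Theorem 1's existence and unique-critical-orbit clauses with B₃ ↦ O(1)C₁B₃ and no (9)–(10)).
* §3 THE BOUND CHAIN (133) ⇒ (136) of p. 298 and THE IMPROVED REGULARITY OF H (137) ⇒ (140) of pp. 298–299 as kernel
  bookkeeping over an abstract seminormed group (the |·|_{(−3)}-currents), every printed INPUT bound a hypothesis and every
  printed CONCLUSION proved with its O(1) explicit: `rhs133_bound` (p. 298 ll. 16–18 «the right-hand side of (133) can be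
  estimated by O(1)C₁B₃ε₁(L^jη)⁻³»), `lapA0_bound` (p. 298 l. 29 «|Δ_{U₀}A₀|_{(−3)} < O(1)C₁B₃ε₁»), `ineq136` ((136)),
  `ineq139` ((139)), `dStarD_HB_bound` (p. 299 l. 10 «|D*DHB|_{(−3)} ≤ O(1)|B|»), `dStarD_HD_bound` (p. 299 l. 11
  «|D*DHD(A′₁)|_{(−3)} ≤ O(1)|D(A′₁)| ≤ O(1)4C₂|A′₁|²_{(−1)} < O(1)C₂(B₁C₁B₃ε₁)²»), `lap_HB_bound` (p. 299 l. 15 «This gives the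
  bound |Δ_{U₀}HB|_{(−3)} ≤ O(1)|B|»), `eps2_secondOrder_bound` (p. 299 ll. 16–18, the second-order part of «satisfying all the
  conditions (19)–(21) with ε₂ = O(1)C₁B₃ε₁»).
* §4 `tildeG` = G̃ := G − GQ*(QGQ*)⁻¹QG (p. 300 l. 8; a `def` with body), `tildeG_eq_proj0_comp` (G̃ = P₀G), `apply_Q_tildeG`
  (QG̃ = 0), **`G_proj0adj_eq_tildeG`** — p. 300 ll. 7–8 «By (131) we have the equality GP₀* = … = G̃» PROVED in an abstract real
  inner-product space (P₀* = the ⟨·,·⟩-adjoint of P₀ as used in (132); G, (QGQ*)⁻¹ symmetric), and **`eq143_of_eq133`**,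
  **`eq143_of_eq128`** — p. 300 ll. 4–10 «Multiplying Eq. (133) by G = Δ_a⁻¹ we obtain … hence the above equation can be written
  as (143)» PROVED from the weak (133) of `B11Eq131Projection.eq133_weak` (resp. from (128)), the functional derivative
  represented by a vector.
* §5 `Hyp` (full name `…B11Carve14SectEHyp.Hyp`) — THE BUNDLE keyed to the consumer: `B11.Prop6Printed ∧
  AtMostOneCriticalIn1921Printed ∧ (∀ i, B11Prop7Assembly.ExistenceLeavesCap (β i) …) ∧ B11.Prop7Printed` over a bridged pair of
  families (Thm-1 carrier `famP`, Sect. A–E carrier `famD`, bridge `β` of `B11Prop7Assembly`); accessors `.prop6`, `.atMostOne`,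
  `.leaves`, `.prop7`, the derived `.exists_minimalOrbit` (`B11Prop7Assembly.exists_minimalOrbit_of_prop6_cap` fed from the
  bundle), `.thm1Worse`, `.eq111_solution`, and `Hyp.of_props` (the second slot is discharged by `Prop5Printed ∧ Prop6Printed`).

## HONEST SCOPE / NOT TYPED

(i) The by-reference sentences «Eqs. (125) have a unique solution» (p. 297 l. 10; = [6] Sect. D / Thm 8), «G′RD* is a bounded
operator in the norm |·|_{(1)}» (p. 299 l. 6; [5]), «DPD* is a bounded operator» (p. 299 l. 14; [5] (3.49)), «Δ′ is a local,
bounded operator satisfying the bound |Δ′HB|_{(−3)} ≤ O(ε₁)|B|» (p. 299 l. 10; [5] (3.10), (3.69)) and «The configuration A₀ =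
A′₁ − H₀B satisfies similar bounds as A′₁» (p. 298 l. 19) are INPUTS of §3 (hypotheses with explicit constants), not typed as
facts — their sources are the B9 rows (`B9.Thm33Printed`, `B9.Thm312_313Printed`, rows B9.Eq3.49 / Eq3.69 / Eq3.137) and
`B8SectGH.Thm8PrintedAt`.  (ii) §3 is bookkeeping of the printed chain in ONE abstract norm standing for |·|_{(−3)} (and real
sizes standing for max{|·|_{(−1)}, |∇·|_{(−2)}}, |·|_{(−1)}, |B|, |D(A′₁)|), exactly the modelling convention of
`B11Prop6Scheme` (cell DIVERGENCE D-B11-20); it shows that the printed O(1)'s compose as claimed («absolute constant depending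
on d and L only» = through the input constants), nothing more.  (iii) The boundedness of P₀* in |·|_{(−3)} used silently in
the (133)-sentence is displayed as the hypothesis `hP` of `rhs133_bound`; the absorption of B₀|B| < 2dLB₀C₁ε₁ into
O(1)C₁B₃ε₁ in (136) uses dL ≤ B₃ (`B11.B3_lower_bounds`), as `B11.ineq118_121` does.  (iv) p. 300 l. 8 prints «GP₀* = G −
GQ*(QGQ*)⁻¹ = G̃» without the trailing «QG» that (131) produces (cell GAPS G-adv7-5, `B11TildeG190` header); `tildeG` is the
(131)-derived operator and `G_proj0adj_eq_tildeG` PROVES GP₀* equals it.  (v) p. 300 ll. 11–17 («it does not imply necessarily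
that solutions satisfy the Landau gauge condition … we have to use both equations») is methodological prose, not typed.
(vi) «at most one critical orbit in the space (6)» with the explicit threshold 16B₁C₁ε₀ ≤ a₄ (p. 296 ll. 19–20) is NOT typed
separately from `B11.Prop7Printed` / `B11Prop7Assembly.atMostOneCriticalOrbit_of_props` (whose a₀ carries the two silent
restrictions of Props 2, 5 — `silent_restrictions`).  (vii) The bundle uses the CAPPED leaves `ExistenceLeavesCap … e₅`
(`B11Prop7Assembly` §7: the uncapped minimality law over-states p. 299, which argues minimality for THE configuration U_k with
ε₀ = O(1)C₁B₃ε₁ small).  (viii) No instance, no notation, no `sorry`; axioms standard.  Nothing here proves a summit statement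
or bears on the Clay problem; the node count does not move.
-/

namespace Literature.MathematicalPhysics.QuantumFieldTheory.Balaban1983to89.B11Carve14SectEHyp

open B11 B11Prop7Assembly

variable {I : Type}

/-! ## §1 p. 296 — consequences of Propositions 5, 6 in the Landau gauge (carrier `B11.LGData`) -/

/-- **p. 296 [PDF 20] ll. 21–22** (verbatim): *«Equation (111) has a solution belonging to the space (115) with ε₄ =
2B₀C₁B₃ε₁, if 2B₀C₁B₃ε₁ ≤ a₄.»* — kernel bookkeeping: this is `B11.Prop6Printed` at ε₄ := 2B₀C₁B₃ε₁ (its hypotheses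
«ε₄ ≤ a₄ and 2B₀C₁B₃ε₁ ≤ ε₄» then read 2B₀C₁B₃ε₁ ≤ a₄), which also gives uniqueness in that space.
[cite: Balaban1985Variational, p.296 ll.21–22 (after (122)); Prop. 6 p.295] -/
theorem eq111_solution_2B0 {B₀ B₃ C₁ : ℝ} {fam : I → LGData} (h6 : Prop6Printed B₀ B₃ C₁ fam) :
    ∃ a₄ : ℝ, 0 < a₄ ∧ ∀ i : I, ∀ ε₁ : ℝ, 0 < ε₁ → 2 * B₀ * C₁ * B₃ * ε₁ ≤ a₄ →
      ∀ V : (fam i).Bdry, ∀ U₀ : (fam i).Cfg, (fam i).Sat14 (C₁ * B₃ * ε₁) (C₁ * ε₁) V U₀ →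
        ∃ A₁ : (fam i).Fld, (fam i).nMax U₀ A₁ < 2 * B₀ * C₁ * B₃ * ε₁ ∧ (fam i).Sol111 V U₀ A₁ ∧
          ∀ A₁' : (fam i).Fld, (fam i).nMax U₀ A₁' < 2 * B₀ * C₁ * B₃ * ε₁ → (fam i).Sol111 V U₀ A₁' → A₁' = A₁ := by
  obtain ⟨a₄, ha₄, H⟩ := h6
  refine ⟨a₄, ha₄, fun i ε₁ hε₁ h2B V U₀ h14 => ?_⟩
  obtain ⟨⟨A₁, hA₁, hsol, _, huniq⟩, _, _⟩ := H i ε₁ (2 * B₀ * C₁ * B₃ * ε₁) hε₁ h2B le_rfl V U₀ h14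
  exact ⟨A₁, hA₁, hsol, huniq⟩

/-- **At most one critical configuration in the Landau gauge** (p. 296 [PDF 20] ll. 9–12, verbatim): *«Now let us draw
some conclusions concerning the basic variational problems (5), (19)–(21), and (5), (6). Let us consider the first problem.
If we take ε₄ = 8ε₂, and if we assume 8ε₂ ≤ a₄ and 2B₀C₁B₃ε₁ ≤ 8ε₂, then by Propositions 5 and 6 there is at most one
critical configuration of (5) in (19)–(21).»*  Typed over the Sect. A–E carrier `B11.LGData` (`In19_21 ε₂ V U₀ U₁` = U₁
satisfies (19)–(21) with ε₂, `CritL V U₀ U₁` = U₁ is a critical configuration of A(U₁U₀) in that space, `Sat14` = the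
background U₀ of (14)), in hypothesis form with the constants the sentence invokes: a₄ = the constant of Proposition 6, and
— «by Propositions 5 and 6» — the restrictions (113) under which Proposition 5 is stated, displayed: B₃ε₁ ≤ ε₀,
B₁(ε₀ + C₁ε₁) ≤ ε₂, ε₂ ≤ ¼ε₃ with ε₃ = 4ε₂ (so that the space (104) is (115) with ε₄ = 2ε₃ = 8ε₂) and «ε₃ sufficiently
small» = the threshold `c`.  Discharged modulo the typed Props 5, 6 by `atMostOneCriticalIn1921_of_props`; its axial-gauge
consequence («We get the same conclusion for the second problem») is `B11.axial_critical_from_one_landau` /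
`B11Prop7Assembly.one_landau_of_props`. [cite: Balaban1985Variational, p.296 ll.9–12 (before (122))] -/
def AtMostOneCriticalIn1921Printed (B₀ B₁ B₃ C₁ : ℝ) (fam : I → LGData) : Prop :=
  ∃ a₄ c : ℝ, 0 < a₄ ∧ 0 < c ∧ ∀ i : I, ∀ ε₀ ε₁ ε₂ : ℝ, 0 < ε₁ → B₃ * ε₁ ≤ ε₀ →
    B₁ * (ε₀ + C₁ * ε₁) ≤ ε₂ → 4 * ε₂ ≤ c → 8 * ε₂ ≤ a₄ → 2 * B₀ * C₁ * B₃ * ε₁ ≤ 8 * ε₂ →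
    ∀ V : (fam i).Bdry, ∀ U₀ : (fam i).Cfg, (fam i).Sat14 (C₁ * B₃ * ε₁) (C₁ * ε₁) V U₀ →
      ∀ U₁ U₁' : (fam i).Pert, (fam i).In19_21 ε₂ V U₀ U₁ → (fam i).CritL V U₀ U₁ →
        (fam i).In19_21 ε₂ V U₀ U₁' → (fam i).CritL V U₀ U₁' → U₁ = U₁'

/-- **«by Propositions 5 and 6»** (p. 296 l. 11) — kernel: `B11.Prop5Printed ∧ B11.Prop6Printed ⇒
AtMostOneCriticalIn1921Printed`, with a₄ = Prop. 6's constant and c = Prop. 5's threshold: two critical U₁, U′₁ in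
(19)–(21) come from solutions A₁, A′₁ of (111) in (104) = (115) with ε₄ = 8ε₂ by Prop. 5, which coincide by the uniqueness
clause of Prop. 6, whence U₁ = T₁₁₂A₁ = T₁₁₂A′₁ = U′₁. [cite: Balaban1985Variational, p.296 ll.9–12 (bookkeeping)] -/
theorem atMostOneCriticalIn1921_of_props {B₀ B₁ B₃ C₁ : ℝ} {fam : I → LGData}
    (h5 : Prop5Printed B₁ B₃ C₁ fam) (h6 : Prop6Printed B₀ B₃ C₁ fam) :
    AtMostOneCriticalIn1921Printed B₀ B₁ B₃ C₁ fam := by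
  obtain ⟨c, hc, H5⟩ := h5
  obtain ⟨a₄, ha₄, H6⟩ := h6
  refine ⟨a₄, c, ha₄, hc, ?_⟩
  intro i ε₀ ε₁ ε₂ hε₁ hB₃ hε₂ h4c h8 h2B V U₀ h14 U₁ U₁' h19 hcr h19' hcr'
  have hq : ε₂ ≤ 4 * ε₂ / 4 := by linarith
  obtain ⟨A₁, hA₁, hsol, hT⟩ := H5 i ε₀ ε₁ ε₂ (4 * ε₂) hε₁ hB₃ hε₂ hq h4c V U₀ h14 U₁ h19 hcr
  obtain ⟨A₁', hA₁', hsol', hT'⟩ := H5 i ε₀ ε₁ ε₂ (4 * ε₂) hε₁ hB₃ hε₂ hq h4c V U₀ h14 U₁' h19' hcr'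
  obtain ⟨⟨A, _, _, _, huniq⟩, _, _⟩ := H6 i ε₁ (8 * ε₂) hε₁ h8 h2B V U₀ h14
  have e1 : A₁ = A := huniq A₁ (by linarith) hsol
  have e2 : A₁' = A := huniq A₁' (by linarith) hsol'
  rw [← hT, ← hT', e1, e2]

/-- **p. 295 [PDF 19] l. 14 and l. 30** (verbatim): *«These conditions [(118)] are satisfied if e.g. 2B₀C₁B₃ε₁ ≤ ε₄ and
ε₄ ≤ a₄ for a sufficiently small a₄.»* … *«Assuming 2B₀C₁B₃ε₁ ≤ ε₄, the above conditions [(121)] are satisfied if ε₄ ≤ a₄,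
where a₄ is a sufficiently small, absolute constant.»* — the EXISTENCE of such an a₄, kernel bookkeeping over
`B11.ineq118_121` (which exhibits a₄ = min{a₃⁄4, (16B₀C₄)⁻¹} under dL ≤ B₃, true for the B₃ of (162) by `B11.B3_lower_bounds`):
both members of (118) and both members of (121) hold for all ε₁, ε₄ ≥ 0 with 2B₀C₁B₃ε₁ ≤ ε₄ ≤ a₄.
[cite: Balaban1985Variational, p.295 l.14 + l.30 ((118), (121)) (bookkeeping)] -/
theorem exists_a4_of_118_121 {dL B₀ C₁ C₄ B₃ a₃ : ℝ} (hdL : 0 ≤ dL) (hB₀ : 0 < B₀) (hC₁ : 0 ≤ C₁) (hC₄ : 0 < C₄)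
    (ha₃ : 0 < a₃) (hB₃ : dL ≤ B₃) :
    ∃ a₄ : ℝ, 0 < a₄ ∧ ∀ ε₁ ε₄ : ℝ, 0 ≤ ε₁ → 0 ≤ ε₄ → 2 * B₀ * C₁ * B₃ * ε₁ ≤ ε₄ → ε₄ ≤ a₄ →
      (ε₄ + 2 * dL * B₀ * C₁ * ε₁ ≤ a₃ ∧
        B₀ * C₁ * B₃ * ε₁ + B₀ * C₄ * (ε₄ + 2 * dL * B₀ * C₁ * ε₁) ^ 2 ≤ ε₄) ∧
      (2 * ε₄ + 4 * dL * B₀ * C₁ * ε₁ ≤ a₃ ∧ 4 * B₀ * C₄ * (ε₄ + 2 * dL * B₀ * C₁ * ε₁) ≤ 1 / 2) := by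
  have hBC : 0 < 16 * B₀ * C₄ := by positivity
  refine ⟨min (a₃ / 4) (1 / (16 * B₀ * C₄)), lt_min (by positivity) (by positivity), ?_⟩
  intro ε₁ ε₄ hε₁ hε₄ h1 hε₄a
  have h2 : 4 * ε₄ ≤ a₃ := by linarith [hε₄a.trans (min_le_left _ _)]
  have h3 : 16 * B₀ * C₄ * ε₄ ≤ 1 := by
    have := hε₄a.trans (min_le_right _ _)
    rw [le_div_iff₀ hBC] at this
    linarith
  exact ineq118_121 dL B₀ C₁ C₄ B₃ a₃ ε₁ ε₄ hdL hB₀.le hC₁ hC₄.le hε₁ hε₄ hB₃ h1 h2 h3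

/-! ## §2 p. 299–300 — «This proposition implies Theorem 1 but with worse bounds … and without (9), (10)» -/

/-- **p. 299 [PDF 23] l. 40 – p. 300 [PDF 24] l. 2** (verbatim): *«This proposition implies Theorem 1 but with worse bounds
on the minimal configuration, and without the regularity results (9), (10). These regularity results and the improved bounds
will be proved in the next section.»* — kernel bookkeeping over the Theorem-1 carrier: from `B11.Prop7Printed B₃ C₁ fam` and
the dictionary `B11.VarProblemX.Laws` (minimal ⇒ critical and in the space; 𝔘_k(e) ⊂ 𝔘_k(e′) for e ≤ e′; «unique critical
orbit» ⇐ critical + every critical configuration on its orbit) follow Theorem 1's first two clauses (p. 279: «there exists a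
minimal orbit in the space 𝔘_k({Ω_j}, B₃ε₁) ∩ 𝔅_k(𝔅_k, V) … This orbit is a unique critical orbit in the space (6) if B₃ε₁ ≤
ε₀ and ε₀ ≤ a₀») with the WORSE constant O(1)C₁B₃ in place of B₃ (so the orbit lies in (6) once O(1)C₁B₃ε₁ ≤ ε₀) and WITHOUT
the regularity clause (9)–(10). [cite: Balaban1985Variational, p.299 l.40–p.300 l.2 (after Prop. 7) (bookkeeping)] -/
theorem thm1Worse_of_prop7 {B₃ C₁ : ℝ} {fam : I → VarProblemX} (laws : ∀ i, (fam i).Laws)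
    (h7 : Prop7Printed B₃ C₁ fam) :
    ∃ a₀ a₁' O₁ : ℝ, 0 < a₀ ∧ 0 < a₁' ∧ 0 < O₁ ∧
      ∀ i : I, ∀ ε₁ : ℝ, 0 < ε₁ → ε₁ ≤ a₁' → ∀ V : (fam i).Bdry, (fam i).Reg7 ε₁ V →
        (∃ U : (fam i).Cfg, (fam i).InU (O₁ * C₁ * B₃ * ε₁) U ∧ (fam i).InB V U ∧
          (fam i).OnMinimalOrbit (O₁ * C₁ * B₃ * ε₁) V U) ∧
        (∀ ε₀ : ℝ, B₃ * ε₁ ≤ ε₀ → O₁ * C₁ * B₃ * ε₁ ≤ ε₀ → ε₀ ≤ a₀ →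
          ∀ U : (fam i).Cfg, (fam i).OnMinimalOrbit (O₁ * C₁ * B₃ * ε₁) V U →
            (fam i).UniqueCriticalOrbit ε₀ V U) := by
  obtain ⟨a₀, a₁', O₁, ha₀, ha₁', hO₁, H7⟩ := h7
  refine ⟨a₀, a₁', O₁, ha₀, ha₁', hO₁, fun i ε₁ hε₁ hε₁a V hV => ⟨?_, ?_⟩⟩
  · obtain ⟨U, hU⟩ := (H7 i a₀ ε₁ hε₁ V hV).2 hε₁a
    obtain ⟨_, hIn, hB⟩ := (laws i).2.1 _ V U hU
    exact ⟨U, hIn, hB, hU⟩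
  · intro ε₀ hB₃ε hOε hε₀a U hU
    obtain ⟨Lmono, Lmin, _, Luniq⟩ := laws i
    obtain ⟨hc, hIn, hB⟩ := Lmin _ V U hU
    have hIn0 : (fam i).InU ε₀ U := Lmono _ _ U hOε hIn
    have hAM := (H7 i ε₀ ε₁ hε₁ V hV).1 hε₀a hB₃ε
    exact Luniq ε₀ V U hIn0 hB hc (fun U' h1' h2' h3' => hAM U' U h1' h2' h3' hIn0 hB hc)

/-! ## §3 pp. 298–299 — the bound chains (133) ⇒ (136) and (137) ⇒ (140), kernel bookkeeping

One abstract seminormed group `𝒵` stands for the 𝔤ᶜ-valued vector fields on Ω₀ with the size |·|_{(−3)} (p. 286: |f|_{(−n)} =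
sup_j (L^jη)ⁿ sup_{Ω_j} |f|; concrete carrier `B11Eq115Space.NegSup`), real letters stand for the sizes of A′₁, A₀, B, D(A′₁);
every printed INPUT bound is a hypothesis with an explicit constant, every printed identity ((134)+(135), Δ = Δ_π + Δ′_π,
(3.10) Δ = D*D + Δ′, (140)+(135)) is a hypothesis between vectors, and what is PROVED is that the printed conclusions follow
with the displayed constants. -/

section Bounds

variable {𝒵 : Type*} [SeminormedAddCommGroup 𝒵]

/-- **The right-hand side of (133)** (p. 298 [PDF 22] ll. 16–18, verbatim): *«The bound (28), the inequality (3.137) [5] for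
the operator Δ^{(2)}, the inequality (97) of Proposition 4, and the bounds |A′₁|_{(−1)}, |∇A′₁|_{(−2)} < ½B₁C₁B₃ε₁ imply that
the right-hand side of (133) can be estimated by O(1)C₁B₃ε₁(L^jη)⁻³ on Ω_j.»* — with (133) «(Δ + DRD*)A₀ = −P₀*J + P₀*Δ^{(2)}A′₁
− P₀*((δ/δA′)V)(A′₁)»: `P` = P₀* on the currents with ‖P₀*z‖ ≤ p‖z‖ (silent in print), ‖J‖ ≤ C₁B₃ε₁ ((28)), ‖Δ^{(2)}A′₁‖ ≤
θ₂·n ((3.137) [5], n = max{|A′₁|_{(−1)}, |∇A′₁|_{(−2)}}), ‖V′(A′₁)‖ ≤ C₄n² ((97)/(98)), n ≤ ½B₁C₁B₃ε₁; conclusion with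
O(1) = p(1 + ½θ₂B₁ + ¼C₄B₁²C₁B₃ε₁). [cite: Balaban1985Variational, p.298 ll.16–18 (after (133)) (bookkeeping)] -/
theorem rhs133_bound (P : 𝒵 → 𝒵) {p θ₂ C₄ B₁ C₁ B₃ ε₁ n : ℝ} (hP : ∀ z, ‖P z‖ ≤ p * ‖z‖) (hp : 0 ≤ p)
    (hθ₂ : 0 ≤ θ₂) (hC₄ : 0 ≤ C₄) (hn : 0 ≤ n) {J X₂ X₃ : 𝒵}
    (hJ : ‖J‖ ≤ C₁ * B₃ * ε₁) (hX₂ : ‖X₂‖ ≤ θ₂ * n) (hX₃ : ‖X₃‖ ≤ C₄ * n ^ 2)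
    (hn' : n ≤ B₁ * C₁ * B₃ * ε₁ / 2) :
    ‖-P J + P X₂ - P X₃‖ ≤ p * (1 + θ₂ * B₁ / 2 + C₄ * B₁ ^ 2 * C₁ * B₃ * ε₁ / 4) * (C₁ * B₃ * ε₁) := by
  have h1 : ‖-P J + P X₂ - P X₃‖ ≤ ‖P J‖ + ‖P X₂‖ + ‖P X₃‖ := by
    calc ‖-P J + P X₂ - P X₃‖ ≤ ‖-P J + P X₂‖ + ‖P X₃‖ := norm_sub_le _ _
      _ ≤ (‖-P J‖ + ‖P X₂‖) + ‖P X₃‖ := by gcongr; exact norm_add_le _ _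
      _ = ‖P J‖ + ‖P X₂‖ + ‖P X₃‖ := by rw [norm_neg]
  have h2 : ‖P J‖ + ‖P X₂‖ + ‖P X₃‖ ≤ p * (‖J‖ + ‖X₂‖ + ‖X₃‖) := by
    have := hP J; have := hP X₂; have := hP X₃; linarith
  have hn2 : n ^ 2 ≤ (B₁ * C₁ * B₃ * ε₁ / 2) ^ 2 := pow_le_pow_left₀ hn hn' 2
  have h3 : ‖J‖ + ‖X₂‖ + ‖X₃‖ ≤ (1 + θ₂ * B₁ / 2 + C₄ * B₁ ^ 2 * C₁ * B₃ * ε₁ / 4) * (C₁ * B₃ * ε₁) := by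
    have e : (1 + θ₂ * B₁ / 2 + C₄ * B₁ ^ 2 * C₁ * B₃ * ε₁ / 4) * (C₁ * B₃ * ε₁) =
        C₁ * B₃ * ε₁ + θ₂ * (B₁ * C₁ * B₃ * ε₁ / 2) + C₄ * (B₁ * C₁ * B₃ * ε₁ / 2) ^ 2 := by ring
    rw [e]
    have := mul_le_mul_of_nonneg_left hn' hθ₂
    have := mul_le_mul_of_nonneg_left hn2 hC₄
    linarith
  calc ‖-P J + P X₂ - P X₃‖ ≤ p * (‖J‖ + ‖X₂‖ + ‖X₃‖) := h1.trans h2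
    _ ≤ p * ((1 + θ₂ * B₁ / 2 + C₄ * B₁ ^ 2 * C₁ * B₃ * ε₁ / 4) * (C₁ * B₃ * ε₁)) :=
        mul_le_mul_of_nonneg_left h3 hp
    _ = p * (1 + θ₂ * B₁ / 2 + C₄ * B₁ ^ 2 * C₁ * B₃ * ε₁ / 4) * (C₁ * B₃ * ε₁) := by ring

/-- **«|Δ_{U₀}A₀|_{(−3)} < O(1)C₁B₃ε₁»** (p. 298 [PDF 22] ll. 25–29, verbatim): *«This way we have expressed (Δ + DRD*)A₀ as a sum
of Δ_{U₀}A₀ and a bounded operator acting on A₀. The bound for this operator follows from the inequality (3.49) [5] for DPD*, the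
inequality (3.69) [5] for Δ′, and the regularity condition (14) for the configuration U₀. This together with (133) and the
discussion following it implies the bound |Δ_{U₀}A₀|_{(−3)} < O(1)C₁B₃ε₁»* — the identities (134) «(Δ + DRD*)A₀ = (D*D + DD*)A₀
+ (Δ′ − DPD*)A₀» and (135) «(D*D + DD*)A₀ = Δ_{U₀}A₀ − 𝒦A₀» (`B11Eq135Weitzenbock.eq134`, `eq135η`) give Δ_{U₀}A₀ = X − Y + K with
X = (Δ + DRD*)A₀ (‖X‖ ≤ r·C₁B₃ε₁ by `rhs133_bound`), Y = (Δ′ − DPD*)A₀, K = 𝒦A₀ («a bounded operator acting on A₀»: ‖Y‖ ≤ b·m,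
‖K‖ ≤ κ·m, m the size of A₀), and p. 298 l. 19 «A₀ = A′₁ − H₀B satisfies similar bounds as A′₁» (m ≤ s·C₁B₃ε₁); conclusion
with O(1) = r + (b + κ)s. [cite: Balaban1985Variational, p.298 ll.19–29 ((134)–(135)) (bookkeeping)] -/
theorem lapA0_bound {L₀ X Y K : 𝒵} {r b κ m s C₁ B₃ ε₁ : ℝ} (h134_135 : L₀ = X - Y + K)
    (hX : ‖X‖ ≤ r * (C₁ * B₃ * ε₁)) (hY : ‖Y‖ ≤ b * m) (hK : ‖K‖ ≤ κ * m) (hb : 0 ≤ b) (hκ : 0 ≤ κ)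
    (hm : m ≤ s * (C₁ * B₃ * ε₁)) :
    ‖L₀‖ ≤ (r + (b + κ) * s) * (C₁ * B₃ * ε₁) := by
  have h1 : ‖L₀‖ ≤ ‖X‖ + ‖Y‖ + ‖K‖ := by
    rw [h134_135]
    calc ‖X - Y + K‖ ≤ ‖X - Y‖ + ‖K‖ := norm_add_le _ _
      _ ≤ ‖X‖ + ‖Y‖ + ‖K‖ := by gcongr; exact norm_sub_le _ _
  have h2 : (b + κ) * m ≤ (b + κ) * (s * (C₁ * B₃ * ε₁)) := mul_le_mul_of_nonneg_left hm (by positivity)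
  nlinarith

/-- **(136)** (p. 298 [PDF 22] ll. 29–30, verbatim): *«hence finally the bound |Δ_{U₀}A′₁| < O(1)C₁B₃ε₁(L^jη)⁻³ on Ω_j, j = 0, 1,
…, k. (136)»* — from A′₁ = A₀ + H₀B: Δ_{U₀}A′₁ = Δ_{U₀}A₀ + Δ_{U₀}H₀B with ‖Δ_{U₀}A₀‖ ≤ s·C₁B₃ε₁ (`lapA0_bound`), (130)
«|Δ_{U₀}H₀B|_{(−3)} ≤ B₀|B|» and (20)/(75) «|B| < 2dLC₁ε₁»; the absorption into O(1)C₁B₃ε₁ uses dL ≤ B₃ (`B11.B3_lower_bounds`):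
O(1) = s + 2B₀. [cite: Balaban1985Variational, (136) p.298 (bookkeeping)] -/
theorem ineq136 {L₁ L₀ LH : 𝒵} {s B₀ nB dL C₁ B₃ ε₁ : ℝ} (hsplit : L₁ = L₀ + LH)
    (hL₀ : ‖L₀‖ ≤ s * (C₁ * B₃ * ε₁)) (h130 : ‖LH‖ ≤ B₀ * nB) (hB : nB ≤ 2 * dL * C₁ * ε₁) (hdL : dL ≤ B₃)
    (hB₀ : 0 ≤ B₀) (hC₁ε₁ : 0 ≤ C₁ * ε₁) :
    ‖L₁‖ ≤ (s + 2 * B₀) * (C₁ * B₃ * ε₁) := by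
  have h1 : ‖L₁‖ ≤ ‖L₀‖ + ‖LH‖ := hsplit ▸ norm_add_le _ _
  have h2 : B₀ * nB ≤ B₀ * (2 * dL * C₁ * ε₁) := mul_le_mul_of_nonneg_left hB hB₀
  have h3 : 2 * dL * C₁ * ε₁ ≤ 2 * B₃ * C₁ * ε₁ := by
    have := mul_le_mul_of_nonneg_right hdL hC₁ε₁
    nlinarith
  nlinarith [mul_le_mul_of_nonneg_left h3 hB₀]

/-- **(139)** (p. 299 [PDF 23] ll. 2–8, verbatim): *«hence |Δ_πHB|_{(−3)} ≤ O(1)|B|. Above we have used the equality RD*H = 0.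
This equality implies also that Δ′_πH simplifies essentially, where Δ_π = Δ − Δ′_π is defined by the formula (3.120) [5]. From
this formula we get (138) and G′RD* is a bounded operator in the norm |·|_{(1)}. The properties of HB and J imply the bound
|Δ′_πHB|_{(−3)} ≤ O(1)|B|, hence |ΔHB|_{(−3)} ≤ O(1)|B|. (139)»* — with Δ = Δ_π + Δ′_π applied to HB (`hsum`), the (137)-bound
(`B11Eq131Projection.norm_eq137_le`, constant k₁) and the (138)-bound (constant k₂): ‖ΔHB‖ ≤ (k₁ + k₂)|B|.
[cite: Balaban1985Variational, (139) p.299 (bookkeeping)] -/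
theorem ineq139 {hπ hπ' hΔ : 𝒵} {k₁ k₂ nB : ℝ} (hsum : hΔ = hπ + hπ') (h137 : ‖hπ‖ ≤ k₁ * nB)
    (h138 : ‖hπ'‖ ≤ k₂ * nB) : ‖hΔ‖ ≤ (k₁ + k₂) * nB := by
  have h1 : ‖hΔ‖ ≤ ‖hπ‖ + ‖hπ'‖ := hsum ▸ norm_add_le _ _
  linarith

/-- **«|D*DHB|_{(−3)} ≤ O(1)|B|»** (p. 299 [PDF 23] ll. 9–11, verbatim): *«Finally we use the decomposition (3.10) [5], i.e. Δ =
D*D + Δ′, Δ′ is a local, bounded operator satisfying the bound |Δ′HB|_{(−3)} ≤ O(ε₁)|B|. This implies the bound |D*DHB|_{(−3)} ≤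
O(1)|B|»* — D*DHB = ΔHB − Δ′HB (`h310`) with (139) (constant k) and ‖Δ′HB‖ ≤ k₃|B|: ‖D*DHB‖ ≤ (k + k₃)|B|.
[cite: Balaban1985Variational, p.299 ll.9–11 (after (139)) (bookkeeping)] -/
theorem dStarD_HB_bound {hΔ h' hDD : 𝒵} {k k₃ nB : ℝ} (h310 : hDD = hΔ - h') (h139 : ‖hΔ‖ ≤ k * nB)
    (hΔ' : ‖h'‖ ≤ k₃ * nB) : ‖hDD‖ ≤ (k + k₃) * nB := by
  have h1 : ‖hDD‖ ≤ ‖hΔ‖ + ‖h'‖ := h310 ▸ norm_sub_le _ _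
  linarith

/-- **«hence |D*DHD(A′₁)|_{(−3)} ≤ O(1)|D(A′₁)| ≤ O(1)4C₂|A′₁|²_{(−1)} < O(1)C₂(B₁C₁B₃ε₁)²»** (p. 299 [PDF 23] l. 11, verbatim) —
the previous bound at B := D(A′₁) (‖D*DHD(A′₁)‖ ≤ k|D(A′₁)|), (55) «|D(A′)| ≤ 4C₂|A′|²_{(−1)}» and |A′₁|_{(−1)} ≤ ½B₁C₁B₃ε₁
(p. 298): the printed constant is exact, 4·(½)² = 1. [cite: Balaban1985Variational, p.299 l.11 (bookkeeping)] -/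
theorem dStarD_HD_bound {hDD : 𝒵} {k C₂ n₁ nD B₁ C₁ B₃ ε₁ : ℝ} (hk : 0 ≤ k) (hC₂ : 0 ≤ C₂) (hn₁ : 0 ≤ n₁)
    (hHD : ‖hDD‖ ≤ k * nD) (h55 : nD ≤ 4 * C₂ * n₁ ^ 2) (hn₁' : n₁ ≤ B₁ * C₁ * B₃ * ε₁ / 2) :
    ‖hDD‖ ≤ k * C₂ * (B₁ * C₁ * B₃ * ε₁) ^ 2 := by
  have hsq : n₁ ^ 2 ≤ (B₁ * C₁ * B₃ * ε₁ / 2) ^ 2 := pow_le_pow_left₀ hn₁ hn₁' 2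
  have h1 : nD ≤ 4 * C₂ * (B₁ * C₁ * B₃ * ε₁ / 2) ^ 2 := h55.trans (mul_le_mul_of_nonneg_left hsq (by positivity))
  have h2 : 4 * C₂ * (B₁ * C₁ * B₃ * ε₁ / 2) ^ 2 = C₂ * (B₁ * C₁ * B₃ * ε₁) ^ 2 := by ring
  calc ‖hDD‖ ≤ k * nD := hHD
    _ ≤ k * (C₂ * (B₁ * C₁ * B₃ * ε₁) ^ 2) := mul_le_mul_of_nonneg_left (h2 ▸ h1) hk
    _ = k * C₂ * (B₁ * C₁ * B₃ * ε₁) ^ 2 := by ring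

/-- **(140) and «This gives the bound |Δ_{U₀}HB|_{(−3)} ≤ O(1)|B|»** (p. 299 [PDF 23] ll. 12–15, verbatim): *«To get a bound for
Δ_{U₀}HB, we write D*DHB = (D*D + DRD*)HB = (D*D + DD*)HB − DPD*HB, (140) and we use again the formula (135), and the fact that
DPD* is a bounded operator. This gives the bound |Δ_{U₀}HB|_{(−3)} ≤ O(1)|B|.»* — (140) with (135) «(D*D + DD*)HB = Δ_{U₀}HB − 𝒦HB»
(`B11Eq135Weitzenbock.eq140_135`) gives Δ_{U₀}HB = D*DHB + DPD*HB + 𝒦HB (`h140_135`), whence with ‖D*DHB‖ ≤ k|B|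
(`dStarD_HB_bound`), ‖DPD*HB‖ ≤ k₄|B| ([5] (3.49) with (46)) and ‖𝒦HB‖ ≤ k₅|B| ((14), `B11Eq135Weitzenbock.norm_curvOp_le_eps`):
‖Δ_{U₀}HB‖ ≤ (k + k₄ + k₅)|B|. [cite: Balaban1985Variational, (140) p.299 + l.15 (bookkeeping)] -/
theorem lap_HB_bound {L hDD hDPD hK : 𝒵} {k k₄ k₅ nB : ℝ} (h140_135 : L = hDD + hDPD + hK)
    (h1 : ‖hDD‖ ≤ k * nB) (h2 : ‖hDPD‖ ≤ k₄ * nB) (h3 : ‖hK‖ ≤ k₅ * nB) :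
    ‖L‖ ≤ (k + k₄ + k₅) * nB := by
  have h0 : ‖L‖ ≤ ‖hDD‖ + ‖hDPD‖ + ‖hK‖ := by
    rw [h140_135]
    calc ‖hDD + hDPD + hK‖ ≤ ‖hDD + hDPD‖ + ‖hK‖ := norm_add_le _ _
      _ ≤ ‖hDD‖ + ‖hDPD‖ + ‖hK‖ := by gcongr; exact norm_add_le _ _
  linarith

/-- **The second-order part of «satisfying all the conditions (19)–(21) with ε₂ = O(1)C₁B₃ε₁»** (p. 299 [PDF 23] ll. 16–18,
verbatim: *«Thus the transformation (47) applied to A′₁ yields the configuration A′₁ − HD(A′₁) = 1/iη log U₁ satisfying all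
the conditions (19)–(21) with ε₂ = O(1)C₁B₃ε₁, where O(1) is an absolute constant depending on d and L only.»*; p. 298 l. 31:
*«we want to prove that the second term HD(A′₁) in this transformation satisfies the above bound [(136)] also»*) — with (136)
(‖Δ_{U₀}A′₁‖ ≤ s·C₁B₃ε₁, `ineq136`) and the bound of the second term (‖Δ_{U₀}HD(A′₁)‖ ≤ kC₂(B₁C₁B₃ε₁)², `dStarD_HD_bound`-shape via
`lap_HB_bound` at B := D(A′₁)) one gets, for ε₁ below any ceiling a, ‖Δ_{U₀}(A′₁ − HD(A′₁))‖ ≤ (s + kC₂B₁²C₁B₃a)·C₁B₃ε₁ — the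
O(1) depends on the input constants only. [cite: Balaban1985Variational, p.299 ll.16–18 (bookkeeping)] -/
theorem eps2_secondOrder_bound {L L₁ LHD : 𝒵} {s k C₂ B₁ C₁ B₃ ε₁ a : ℝ} (hsplit : L = L₁ - LHD)
    (h136 : ‖L₁‖ ≤ s * (C₁ * B₃ * ε₁)) (hHD : ‖LHD‖ ≤ k * C₂ * (B₁ * C₁ * B₃ * ε₁) ^ 2) (hk : 0 ≤ k)
    (hC₂ : 0 ≤ C₂) (hC₁ : 0 ≤ C₁) (hB₃ : 0 ≤ B₃) (hε₁ : 0 ≤ ε₁) (hε₁a : ε₁ ≤ a) :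
    ‖L‖ ≤ (s + k * C₂ * B₁ ^ 2 * C₁ * B₃ * a) * (C₁ * B₃ * ε₁) := by
  have h1 : ‖L‖ ≤ ‖L₁‖ + ‖LHD‖ := hsplit ▸ norm_sub_le _ _
  have h2 : k * C₂ * (B₁ * C₁ * B₃ * ε₁) ^ 2 = (k * C₂ * B₁ ^ 2 * C₁ * B₃ * ε₁) * (C₁ * B₃ * ε₁) := by ring
  have h3 : k * C₂ * B₁ ^ 2 * C₁ * B₃ * ε₁ ≤ k * C₂ * B₁ ^ 2 * C₁ * B₃ * a :=
    mul_le_mul_of_nonneg_left hε₁a (by positivity)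
  have h4 : 0 ≤ C₁ * B₃ * ε₁ := by positivity
  nlinarith [mul_le_mul_of_nonneg_right h3 h4]

end Bounds

/-! ## §4 p. 300 — the alternative equation (143): «GP₀* = G − GQ*(QGQ*)⁻¹QG = G̃» and «Multiplying Eq. (133) by G»

Vocabulary of `B11Eq129Minimizer` / `B11Eq131Projection` (abstract real inner-product spaces `E` = fields A′, `F` = block data;
`G` = Δ_a⁻¹, `Q`, its adjoint `Qadj` = Q*, `Kinv` = (QGQ*)⁻¹, `hOp G Qadj Kinv` = H₀ of (129), `proj0 G Q Qadj Kinv` = P₀ of (131)). -/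

section TildeG

open scoped InnerProductSpace
open B11Eq129Minimizer (hOp)
open B11Eq131Projection (proj0 proj0_apply eq133_weak)

variable {E F : Type*} [NormedAddCommGroup E] [InnerProductSpace ℝ E] [NormedAddCommGroup F]
  [InnerProductSpace ℝ F]

/-- **G̃ := G − GQ*(QGQ*)⁻¹QG** — the operator of the alternative equation (143) (p. 300 [PDF 24] ll. 7–8: *«By (131) we have the
equality GP₀* = G − GQ*(QGQ*)⁻¹[QG] = G̃»*; the display prints the middle member without the trailing factor QG that (131)
produces — cell GAPS G-adv7-5, `B11TildeG190` — the definition here is the (131)-derived one, = `B11TildeG190`'s hypothesis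
`hGt`). [cite: Balaban1985Variational, p.300 ll.7–8 (before (143))] -/
def tildeG (G : E →ₗ[ℝ] E) (Q : E →ₗ[ℝ] F) (Qadj : F →ₗ[ℝ] E) (Kinv : F →ₗ[ℝ] F) : E →ₗ[ℝ] E :=
  G - G ∘ₗ Qadj ∘ₗ Kinv ∘ₗ Q ∘ₗ G

variable {G : E →ₗ[ℝ] E} {Q : E →ₗ[ℝ] F} {Qadj : F →ₗ[ℝ] E} {Kinv : F →ₗ[ℝ] F}

/-- Unfolding `tildeG`: G̃x = Gx − GQ*(QGQ*)⁻¹QGx. [cite: Balaban1985Variational, p.300 l.8] -/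
theorem tildeG_apply (x : E) : tildeG G Q Qadj Kinv x = G x - G (Qadj (Kinv (Q (G x)))) := rfl

/-- G̃ = P₀G for the projection P₀ = I − GQ*(QGQ*)⁻¹Q of (131) (`B11Eq131Projection.proj0`) — the algebra behind «By (131)».
[cite: Balaban1985Variational, (131) p.298, p.300 l.8 (bookkeeping)] -/
theorem tildeG_eq_proj0_comp : tildeG G Q Qadj Kinv = proj0 G Q Qadj Kinv ∘ₗ G := by
  ext x
  rw [LinearMap.comp_apply, proj0_apply, hOp, tildeG_apply]

/-- The range of G̃ lies in {QA = 0}: QG̃ = QG − (QGQ*)(QGQ*)⁻¹QG = 0 (the constraint QA₀ = 0 of (143)'s unknown is automatic,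
cf. `B11Prop6Scheme.solution_mem_submodule`). [cite: Balaban1985Variational, p.300 (143) (bookkeeping)] -/
theorem apply_Q_tildeG (hK : ∀ y : F, Q (G (Qadj (Kinv y))) = y) (x : E) : Q (tildeG G Q Qadj Kinv x) = 0 := by
  rw [tildeG_apply, map_sub, hK, sub_self]

/-- **«By (131) we have the equality GP₀* = G − GQ*(QGQ*)⁻¹[QG] = G̃»** (p. 300 [PDF 24] ll. 7–8) PROVED: for P₀* the adjoint of
P₀ with respect to the scalar product ⟨·,·⟩ in which (128), (132)–(133) are written (`hP0adj`; this is how P₀* enters (132):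
⟨P₀A′, X⟩ = ⟨A′, P₀*X⟩), G = Δ_a⁻¹ symmetric (`hGsymm`; [5] Thm 3.11: Δ_a, G positive definite), (QGQ*)⁻¹ symmetric (`hKsymm`)
and Q* the adjoint of Q (`hadj`), one has G(P₀*y) = G̃y for every y. [cite: Balaban1985Variational, p.300 ll.7–8 ((131) ⇒ GP₀* = G̃)] -/
theorem G_proj0adj_eq_tildeG (hGsymm : ∀ x y : E, ⟪G x, y⟫_ℝ = ⟪x, G y⟫_ℝ)
    (hadj : ∀ (x : E) (y : F), ⟪Q x, y⟫_ℝ = ⟪x, Qadj y⟫_ℝ) (hKsymm : ∀ u v : F, ⟪Kinv u, v⟫_ℝ = ⟪u, Kinv v⟫_ℝ)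
    {P0adj : E →ₗ[ℝ] E} (hP0adj : ∀ x y : E, ⟪proj0 G Q Qadj Kinv x, y⟫_ℝ = ⟪x, P0adj y⟫_ℝ) (y : E) :
    G (P0adj y) = tildeG G Q Qadj Kinv y := by
  have hadj' : ∀ (u : F) (v : E), ⟪Qadj u, v⟫_ℝ = ⟪u, Q v⟫_ℝ := fun u v =>
    calc ⟪Qadj u, v⟫_ℝ = ⟪v, Qadj u⟫_ℝ := (real_inner_comm (Qadj u) v).symm
      _ = ⟪Q v, u⟫_ℝ := (hadj v u).symm
      _ = ⟪u, Q v⟫_ℝ := real_inner_comm u (Q v)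
  refine ext_inner_left ℝ fun x => ?_
  calc ⟪x, G (P0adj y)⟫_ℝ = ⟪G x, P0adj y⟫_ℝ := (hGsymm x (P0adj y)).symm
    _ = ⟪proj0 G Q Qadj Kinv (G x), y⟫_ℝ := (hP0adj (G x) y).symm
    _ = ⟪G x, y⟫_ℝ - ⟪G (Qadj (Kinv (Q (G x)))), y⟫_ℝ := by rw [proj0_apply, inner_sub_left, hOp]
    _ = ⟪x, G y⟫_ℝ - ⟪x, G (Qadj (Kinv (Q (G y))))⟫_ℝ := by
        rw [hGsymm x y, hGsymm (Qadj (Kinv (Q (G x)))) y, hadj' (Kinv (Q (G x))) (G y),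
          hKsymm (Q (G x)) (Q (G y)), hadj (G x) (Kinv (Q (G y))), hGsymm x (Qadj (Kinv (Q (G y))))]
    _ = ⟪x, tildeG G Q Qadj Kinv y⟫_ℝ := by rw [tildeG_apply, inner_sub_right]

/-- **(143) from (133)** (p. 300 [PDF 24] ll. 4–10, verbatim): *«Multiplying Eq. (133) by G = Δ_a⁻¹ we obtain A₀ = −GP₀*J +
GP₀*Δ^{(2)}A′₁ − GP₀*((δ/δA′)V)(A′₁), where A′₁ = A₀ + H₀B. By (131) we have the equality GP₀* = … = G̃, hence the above equation
can be written as A₀ = −G̃J + G̃Δ^{(2)}(A₀ + H₀B) − G̃((δ/δA′)V)(A₀ + H₀B). (143)»* — PROVED from the weak form of (133) as certified in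
`B11Eq131Projection.eq133_weak` (`h133`: ⟨A′, Δ_aA₀⟩ = −⟨P₀A′, J⟩ + ⟨P₀A′, Δ^{(2)}A′₁⟩ − V′(A′₁)[P₀A′] for all A′), the functional
derivative V′(A′₁) represented by the vector W (`hW`), G a left inverse of Δ_a (`hGΔ`, «G = Δ_a⁻¹»), and `G_proj0adj_eq_tildeG`.
[cite: Balaban1985Variational, (143) p.300] -/
theorem eq143_of_eq133 {Δ Δ2 : E →ₗ[ℝ] E} (hGΔ : ∀ x : E, G (Δ x) = x)
    (hGsymm : ∀ x y : E, ⟪G x, y⟫_ℝ = ⟪x, G y⟫_ℝ) (hadj : ∀ (x : E) (y : F), ⟪Q x, y⟫_ℝ = ⟪x, Qadj y⟫_ℝ)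
    (hKsymm : ∀ u v : F, ⟪Kinv u, v⟫_ℝ = ⟪u, Kinv v⟫_ℝ)
    {P0adj : E →ₗ[ℝ] E} (hP0adj : ∀ x y : E, ⟪proj0 G Q Qadj Kinv x, y⟫_ℝ = ⟪x, P0adj y⟫_ℝ)
    {J A₀ W : E} {b : F} {DV : E →ₗ[ℝ] ℝ} (hW : ∀ x : E, DV x = ⟪x, W⟫_ℝ)
    (h133 : ∀ A : E, ⟪A, Δ A₀⟫_ℝ = -⟪proj0 G Q Qadj Kinv A, J⟫_ℝ
      + ⟪proj0 G Q Qadj Kinv A, Δ2 (A₀ + hOp G Qadj Kinv b)⟫_ℝ - DV (proj0 G Q Qadj Kinv A)) :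
    A₀ = -(tildeG G Q Qadj Kinv J) + tildeG G Q Qadj Kinv (Δ2 (A₀ + hOp G Qadj Kinv b))
      - tildeG G Q Qadj Kinv W := by
  -- (133) in vector form: Δ_aA₀ = P₀*(−J + Δ^{(2)}A′₁ − V′(A′₁))
  have hΔA₀ : Δ A₀ = P0adj (-J + Δ2 (A₀ + hOp G Qadj Kinv b) - W) := by
    refine ext_inner_left ℝ fun A => ?_
    rw [h133 A, hW, ← hP0adj, inner_sub_right, inner_add_right, inner_neg_right]
  -- «Multiplying Eq. (133) by G = Δ_a⁻¹»
  have hA₀ : A₀ = G (P0adj (-J + Δ2 (A₀ + hOp G Qadj Kinv b) - W)) := by rw [← hΔA₀, hGΔ]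
  rw [G_proj0adj_eq_tildeG hGsymm hadj hKsymm hP0adj, map_sub, map_add, map_neg] at hA₀
  exact hA₀

/-- **(143) from (128)**: the whole p. 298–300 derivation BY NAME — (128) on {QδA′ = 0} (`h128`, with A′₁ = A₀ + H₀b, QA₀ = 0)
⇒ (132)–(133) (`B11Eq131Projection.eq133_weak`) ⇒ (143) (`eq143_of_eq133`). Hypotheses: Δ_a symmetric with two-sided inverse G
(`hΔG`, `hGΔ`, hence G symmetric — supplied as `hGsymm`), Q/Q* an adjoint pair, (QGQ*)(QGQ*)⁻¹ = I (`hK`), (QGQ*)⁻¹ symmetric,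
P₀* the adjoint of P₀, V′(A′₁) = ⟨·, W⟩. [cite: Balaban1985Variational, (128) p.297, (131)–(133) p.298, (143) p.300 (bookkeeping)] -/
theorem eq143_of_eq128 {Δ Δ2 : E →ₗ[ℝ] E} (hsymm : ∀ x y : E, ⟪Δ x, y⟫_ℝ = ⟪x, Δ y⟫_ℝ)
    (hΔG : ∀ x : E, Δ (G x) = x) (hGΔ : ∀ x : E, G (Δ x) = x)
    (hGsymm : ∀ x y : E, ⟪G x, y⟫_ℝ = ⟪x, G y⟫_ℝ) (hadj : ∀ (x : E) (y : F), ⟪Q x, y⟫_ℝ = ⟪x, Qadj y⟫_ℝ)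
    (hK : ∀ y : F, Q (G (Qadj (Kinv y))) = y) (hKsymm : ∀ u v : F, ⟪Kinv u, v⟫_ℝ = ⟪u, Kinv v⟫_ℝ)
    {P0adj : E →ₗ[ℝ] E} (hP0adj : ∀ x y : E, ⟪proj0 G Q Qadj Kinv x, y⟫_ℝ = ⟪x, P0adj y⟫_ℝ)
    {J A₀ W : E} {b : F} (hA₀ : Q A₀ = 0) {DV : E →ₗ[ℝ] ℝ} (hW : ∀ x : E, DV x = ⟪x, W⟫_ℝ)
    (h128 : ∀ δ : E, Q δ = 0 →
      ⟪δ, J⟫_ℝ + ⟪δ, Δ (A₀ + hOp G Qadj Kinv b)⟫_ℝ - ⟪δ, Δ2 (A₀ + hOp G Qadj Kinv b)⟫_ℝ + DV δ = 0) :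
    A₀ = -(tildeG G Q Qadj Kinv J) + tildeG G Q Qadj Kinv (Δ2 (A₀ + hOp G Qadj Kinv b))
      - tildeG G Q Qadj Kinv W :=
  eq143_of_eq133 hGΔ hGsymm hadj hKsymm hP0adj hW (eq133_weak hsymm hΔG hadj hK hA₀ DV h128)

end TildeG

/-! ## §5 The bundle of block 14 (pp. 294–300) keyed to the consumer -/

/-- **BLOCK 14 OF [Balaban1985Variational] (SECT. E) IN HYPOTHESIS FORM** — the printed statements of pp. 294–300 conjoined BY NAME
over the carriers of record: **Proposition 6** pp. 295–296 (`B11.Prop6Printed B₀ B₃ C₁ famD`, Sect. A–E family `famD`), the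
Landau-gauge uniqueness sentence of p. 296 (`AtMostOneCriticalIn1921Printed B₀ B₁ B₃ C₁ famD`), the located existence chain of
pp. 296–299 — (112) ↦ critical U₁ in (19)–(21) with ε₂ = O₁C₁B₃ε₁ (p. 296 + p. 299 ll. 16–18), axial gauge «Proposition 7 [6]» ↦ U_k ∈
(18) with ε₀ = O₂ε₂ critical (p. 299 ll. 18–23), (141)–(142) ↦ minimal for spaces 𝔘(e), e ≤ e₅ (p. 299 ll. 23–35) — as the capped
leaves `B11Prop7Assembly.ExistenceLeavesCap (β i) B₀ B₃ C₁ O₁ O₂ e₅` over the bridge `β` between the Theorem-1 carrier `famP` and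
`famD` ((15) U = U′U₀), and **Proposition 7** p. 299 (`B11.Prop7Printed B₃ C₁ famP`).  A node prover takes
`(h : Hyp B₀ B₁ B₃ C₁ O₁ O₂ e₅ famP famD β)`; the PROVED rows of these pages (module docstring, § IN TREE) need no slot, and the
second slot is itself discharged by `B11.Prop5Printed ∧ B11.Prop6Printed` (`Hyp.of_props`).
[cite: Balaban1985Variational, Prop. 6 p.295 + p.296 ll.9–12 + pp.296–299 (112)–(142) + Prop. 7 p.299 (bundle by name)] -/
def Hyp {I : Type} (B₀ B₁ B₃ C₁ O₁ O₂ e₅ : ℝ) (famP : I → VarProblemX) (famD : I → LGData)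
    (β : ∀ i, Bridge (famP i) (famD i)) : Prop :=
  Prop6Printed B₀ B₃ C₁ famD ∧
    AtMostOneCriticalIn1921Printed B₀ B₁ B₃ C₁ famD ∧
    (∀ i, ExistenceLeavesCap (β i) B₀ B₃ C₁ O₁ O₂ e₅) ∧
    Prop7Printed B₃ C₁ famP

namespace Hyp

variable {B₀ B₁ B₃ C₁ O₁ O₂ e₅ : ℝ} {famP : I → VarProblemX} {famD : I → LGData}
  {β : ∀ i, Bridge (famP i) (famD i)}

/-- Accessor: Proposition 6 (pp. 295–296) by name. [cite: Balaban1985Variational, Prop. 6 p.295] -/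
theorem prop6 (h : Hyp B₀ B₁ B₃ C₁ O₁ O₂ e₅ famP famD β) : Prop6Printed B₀ B₃ C₁ famD := h.1

/-- Accessor: the p. 296 Landau-gauge uniqueness sentence. [cite: Balaban1985Variational, p.296 ll.9–12] -/
theorem atMostOne (h : Hyp B₀ B₁ B₃ C₁ O₁ O₂ e₅ famP famD β) : AtMostOneCriticalIn1921Printed B₀ B₁ B₃ C₁ famD :=
  h.2.1

/-- Accessor: the located existence leaves of pp. 296–299 (capped), by name. [cite: Balaban1985Variational, pp.296–299 (112)–(142)] -/
theorem leaves (h : Hyp B₀ B₁ B₃ C₁ O₁ O₂ e₅ famP famD β) (i : I) : ExistenceLeavesCap (β i) B₀ B₃ C₁ O₁ O₂ e₅ :=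
  h.2.2.1 i

/-- Accessor: Proposition 7 (p. 299) by name. [cite: Balaban1985Variational, Prop. 7 p.299] -/
theorem prop7 (h : Hyp B₀ B₁ B₃ C₁ O₁ O₂ e₅ famP famD β) : Prop7Printed B₃ C₁ famP := h.2.2.2

/-- The bundle from its parts, the uniqueness slot discharged by Propositions 5, 6 (`atMostOneCriticalIn1921_of_props`).
[cite: Balaban1985Variational, p.296 l.11 «by Propositions 5 and 6» (bookkeeping)] -/
theorem of_props (h5 : Prop5Printed B₁ B₃ C₁ famD) (h6 : Prop6Printed B₀ B₃ C₁ famD)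
    (hl : ∀ i, ExistenceLeavesCap (β i) B₀ B₃ C₁ O₁ O₂ e₅) (h7 : Prop7Printed B₃ C₁ famP) :
    Hyp B₀ B₁ B₃ C₁ O₁ O₂ e₅ famP famD β :=
  ⟨h6, atMostOneCriticalIn1921_of_props h5 h6, hl, h7⟩

/-- Derived: p. 296 ll. 21–22 «Equation (111) has a solution belonging to the space (115) with ε₄ = 2B₀C₁B₃ε₁, if 2B₀C₁B₃ε₁ ≤ a₄»
(`eq111_solution_2B0` fed from the bundle). [cite: Balaban1985Variational, p.296 ll.21–22 (bookkeeping)] -/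
theorem eq111_solution (h : Hyp B₀ B₁ B₃ C₁ O₁ O₂ e₅ famP famD β) :
    ∃ a₄ : ℝ, 0 < a₄ ∧ ∀ i : I, ∀ ε₁ : ℝ, 0 < ε₁ → 2 * B₀ * C₁ * B₃ * ε₁ ≤ a₄ →
      ∀ V : (famD i).Bdry, ∀ U₀ : (famD i).Cfg, (famD i).Sat14 (C₁ * B₃ * ε₁) (C₁ * ε₁) V U₀ →
        ∃ A₁ : (famD i).Fld, (famD i).nMax U₀ A₁ < 2 * B₀ * C₁ * B₃ * ε₁ ∧ (famD i).Sol111 V U₀ A₁ ∧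
          ∀ A₁' : (famD i).Fld, (famD i).nMax U₀ A₁' < 2 * B₀ * C₁ * B₃ * ε₁ → (famD i).Sol111 V U₀ A₁' →
            A₁' = A₁ :=
  eq111_solution_2B0 h.prop6

/-- Derived: the existence clause of Proposition 7 ASSEMBLED from the bundle's Prop. 6 and leaves — «If ε₁ ≤ a′₁, then there
exists a minimal orbit in the space (6) with ε₀ = O(1)C₁B₃ε₁» for every background U₀ of (14), a′₁ = min{a₄⁄(2B₀C₁B₃),
e₅⁄(O₂O₁C₁B₃)}, O(1) = O₂O₁ (`B11Prop7Assembly.exists_minimalOrbit_of_prop6_cap`). [cite: Balaban1985Variational, Prop. 7 p.299 (bookkeeping)] -/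
theorem exists_minimalOrbit (h : Hyp B₀ B₁ B₃ C₁ O₁ O₂ e₅ famP famD β) (hB₀ : 0 < B₀) (hB₃ : 0 < B₃) (hC₁ : 0 < C₁)
    (hO₁ : 0 < O₁) (hO₂ : 0 < O₂) (he₅ : 0 < e₅) :
    ∃ a₁' O : ℝ, 0 < a₁' ∧ 0 < O ∧ ∀ i : I, ∀ ε₁ : ℝ, 0 < ε₁ → ε₁ ≤ a₁' →
      ∀ (V : (famP i).Bdry) (U₀ : (famD i).Cfg), (famD i).Sat14 (C₁ * B₃ * ε₁) (C₁ * ε₁) ((β i).bdry V) U₀ →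
        ∃ U : (famP i).Cfg, (famP i).OnMinimalOrbit (O * C₁ * B₃ * ε₁) V U :=
  exists_minimalOrbit_of_prop6_cap β h.leaves hB₀ hB₃ hC₁ hO₁ hO₂ he₅ h.prop6

/-- Derived: «This proposition implies Theorem 1 but with worse bounds on the minimal configuration, and without the regularity
results (9), (10)» (`thm1Worse_of_prop7` fed from the bundle, given the dictionary `B11.VarProblemX.Laws`).
[cite: Balaban1985Variational, p.299 l.40–p.300 l.2 (bookkeeping)] -/
theorem thm1Worse (h : Hyp B₀ B₁ B₃ C₁ O₁ O₂ e₅ famP famD β) (laws : ∀ i, (famP i).Laws) :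
    ∃ a₀ a₁' O : ℝ, 0 < a₀ ∧ 0 < a₁' ∧ 0 < O ∧
      ∀ i : I, ∀ ε₁ : ℝ, 0 < ε₁ → ε₁ ≤ a₁' → ∀ V : (famP i).Bdry, (famP i).Reg7 ε₁ V →
        (∃ U : (famP i).Cfg, (famP i).InU (O * C₁ * B₃ * ε₁) U ∧ (famP i).InB V U ∧
          (famP i).OnMinimalOrbit (O * C₁ * B₃ * ε₁) V U) ∧
        (∀ ε₀ : ℝ, B₃ * ε₁ ≤ ε₀ → O * C₁ * B₃ * ε₁ ≤ ε₀ → ε₀ ≤ a₀ →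
          ∀ U : (famP i).Cfg, (famP i).OnMinimalOrbit (O * C₁ * B₃ * ε₁) V U →
            (famP i).UniqueCriticalOrbit ε₀ V U) :=
  thm1Worse_of_prop7 laws h.prop7

end Hyp

end Literature.MathematicalPhysics.QuantumFieldTheory.Balaban1983to89.B11Carve14SectEHyp
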